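import Summits.KontsevichZagierPeriods.KontsevichZagierPeriods.Theorems.GpcLegendreLemniscatic.Negative.Canonical
import Literature.NumberTheory.Transcendental.KZLogCalculusProofs

/-!
# Crux `LegendreAllModuli` (stmt-KontsevichZagierPeriods-3523), line `Sketch`: stub M4

Registered stub `stub_stripNewtonLeibniz` of the line skeleton.

ONE Newton–Leibniz move (Kontsevich–Zagier rule (3)) along the last coordinate of the half-strip
`H = {0 < z0} ∩ {0 < z1 < 1}` with integrand `g z = 1/(1 + z0²)`:

* primitive `F z = z1/(1 + z0²)`, bounds `a ≡ 0`, `b ≡ 1` over the base `(0,∞) ⊆ ℝ¹`, so that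
  `[closed band {0 < z0} × [0,1], g] − [(0,∞), 1/(1 + y²)] ∈ newtonLeibnizRel`;
* the closed band and the open strip differ by the two null faces `z1 ∈ {0,1}` (rule (1a) and
  `of_mem_relations_of_volume_eq_zero`);
* the given representation `p` differs from the canonical strip representation only off the
  common domain (`of_sub_of_mem_relations_of_eqOn`).

Sets used below (all written out explicitly, no definitions are introduced):
the base `{y : Fin 1 → ℝ | 0 < y 0}`, the closed band `{z | 0 < z 0 ∧ 0 ≤ z 1 ∧ z 1 ≤ 1}`,
the open strip `{z | 0 < z 0 ∧ 0 < z 1 ∧ z 1 < 1}`, the faces `{z | 0 < z 0 ∧ (z 1 = 0 ∨ z 1 = 1)}`.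
All auxiliary lemmas live in the sub-namespace `M4`; the registered stub is the last theorem.
References: Kontsevich–Zagier 2001, §1.2 rules (1), (3).

Adapted from `Cruxes/GpcLegendreLemniscatic/DrefuteLineStubs.lean` §B (drefute seat, stmt-0280).
-/

noncomputable section

open MeasureTheory Set
open Literature.NumberTheory.Transcendental
open Literature.NumberTheory.Transcendental.KZ
open Literature.ModelTheory.ExponentialFields (IsSemialgebraic)
open MvPolynomial (aeval X C)
open Summit.KontsevichZagierPeriods.Grothendieck.GpcLegendreLemniscaticNegative

namespace Summit.KontsevichZagierPeriods.UnfoldedStokes.LegendreAllModuliLine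

namespace M4

-- adapted from Cruxes/GpcLegendreLemniscatic/DrefuteLineStubs.lean §B (drefute seat, stmt-0280)

/-! ## Sets: decomposition of the closed band and nullity of the faces -/

/-- Closed band = open strip ∪ faces. [folklore] -/
theorem band_eq_union :
    {z : Fin 2 → ℝ | 0 < z 0 ∧ 0 ≤ z 1 ∧ z 1 ≤ 1} =
      {z : Fin 2 → ℝ | 0 < z 0 ∧ 0 < z 1 ∧ z 1 < 1} ∪ {z | 0 < z 0 ∧ (z 1 = 0 ∨ z 1 = 1)} := by
  ext z
  simp only [mem_union, mem_setOf_eq]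
  constructor
  · rintro ⟨h0, h1, h2⟩
    rcases h1.lt_or_eq with h1 | h1
    · rcases h2.lt_or_eq with h2 | h2
      · exact Or.inl ⟨h0, h1, h2⟩
      · exact Or.inr ⟨h0, Or.inr h2⟩
    · exact Or.inr ⟨h0, Or.inl h1.symm⟩
  · rintro (⟨h0, h1, h2⟩ | ⟨h0, h1 | h1⟩)
    · exact ⟨h0, h1.le, h2.le⟩
    · exact ⟨h0, h1.symm.le, by rw [h1]; norm_num⟩
    · exact ⟨h0, by rw [h1]; norm_num, h1.le⟩

/-- The open strip lies in the closed band. [folklore] -/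
theorem strip_subset_band :
    {z : Fin 2 → ℝ | 0 < z 0 ∧ 0 < z 1 ∧ z 1 < 1} ⊆ {z | 0 < z 0 ∧ 0 ≤ z 1 ∧ z 1 ≤ 1} := by
  rw [band_eq_union]; exact subset_union_left

/-- The faces lie in the closed band. [folklore] -/
theorem face_subset_band :
    {z : Fin 2 → ℝ | 0 < z 0 ∧ (z 1 = 0 ∨ z 1 = 1)} ⊆ {z | 0 < z 0 ∧ 0 ≤ z 1 ∧ z 1 ≤ 1} := by
  rw [band_eq_union]; exact subset_union_right

/-- The open strip and the faces are disjoint. [folklore] -/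
theorem strip_inter_face :
    {z : Fin 2 → ℝ | 0 < z 0 ∧ 0 < z 1 ∧ z 1 < 1} ∩ {z | 0 < z 0 ∧ (z 1 = 0 ∨ z 1 = 1)} = ∅ := by
  ext z
  simp only [mem_inter_iff, mem_setOf_eq, mem_empty_iff_false, iff_false, not_and]
  rintro ⟨_, h1, h2⟩ _ (h | h)
  · rw [h] at h1; exact lt_irrefl _ h1
  · rw [h] at h2; exact lt_irrefl _ h2

/-- The open strip meets the faces in a null set (indeed the empty set). [folklore] -/
theorem volume_strip_inter_face :
    volume ({z : Fin 2 → ℝ | 0 < z 0 ∧ 0 < z 1 ∧ z 1 < 1} ∩ {z | 0 < z 0 ∧ (z 1 = 0 ∨ z 1 = 1)})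
      = 0 := by
  rw [strip_inter_face, measure_empty]

/-- The faces are Lebesgue-null (two hyperplanes `z1 = 0`, `z1 = 1`). [folklore] -/
theorem volume_face : volume {z : Fin 2 → ℝ | 0 < z 0 ∧ (z 1 = 0 ∨ z 1 = 1)} = 0 := by
  have h0 : volume {z : Fin 2 → ℝ | z (Fin.last 1) = 0} = 0 :=
    volume_setOf_last_eq_zero (n := 1) 0
  have h1 : volume {z : Fin 2 → ℝ | z (Fin.last 1) = 1} = 0 :=
    volume_setOf_last_eq_zero (n := 1) 1
  refine measure_mono_null (fun z hz => ?_) (measure_union_null h0 h1)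
  rcases hz.2 with h | h
  · exact Or.inl h
  · exact Or.inr h

/-! ## Semialgebraicity -/

/-- `{0 < z0} ⊆ ℝ²` is `ℚ`-semialgebraic. [folklore] -/
theorem isSemialgebraic_pos0 : IsSemialgebraic ℚ {z : Fin 2 → ℝ | 0 < z 0} := by
  simpa using Literature.ModelTheory.ExponentialFields.isSemialgebraic_setOf_eval_lt (k := ℚ)
    (R := ℝ) (0 : MvPolynomial (Fin 2) ℚ) (X 0)

/-- `{0 < z1} ⊆ ℝ²` is `ℚ`-semialgebraic. [folklore] -/
theorem isSemialgebraic_pos1 : IsSemialgebraic ℚ {z : Fin 2 → ℝ | 0 < z 1} := by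
  simpa using Literature.ModelTheory.ExponentialFields.isSemialgebraic_setOf_eval_lt (k := ℚ)
    (R := ℝ) (0 : MvPolynomial (Fin 2) ℚ) (X 1)

/-- `{z1 < 1} ⊆ ℝ²` is `ℚ`-semialgebraic. [folklore] -/
theorem isSemialgebraic_lt1 : IsSemialgebraic ℚ {z : Fin 2 → ℝ | z 1 < 1} := by
  simpa using Literature.ModelTheory.ExponentialFields.isSemialgebraic_setOf_eval_lt (k := ℚ)
    (R := ℝ) (X 1 : MvPolynomial (Fin 2) ℚ) 1

/-- `{0 ≤ z1} ⊆ ℝ²` is `ℚ`-semialgebraic. [folklore] -/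
theorem isSemialgebraic_nonneg1 : IsSemialgebraic ℚ {z : Fin 2 → ℝ | 0 ≤ z 1} := by
  simpa using Literature.ModelTheory.ExponentialFields.isSemialgebraic_setOf_eval_le (k := ℚ)
    (R := ℝ) (0 : MvPolynomial (Fin 2) ℚ) (X 1)

/-- `{z1 ≤ 1} ⊆ ℝ²` is `ℚ`-semialgebraic. [folklore] -/
theorem isSemialgebraic_le1 : IsSemialgebraic ℚ {z : Fin 2 → ℝ | z 1 ≤ 1} := by
  simpa using Literature.ModelTheory.ExponentialFields.isSemialgebraic_setOf_eval_le (k := ℚ)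
    (R := ℝ) (X 1 : MvPolynomial (Fin 2) ℚ) 1

/-- `{z1 = 0} ⊆ ℝ²` is `ℚ`-semialgebraic. [folklore] -/
theorem isSemialgebraic_eq0 : IsSemialgebraic ℚ {z : Fin 2 → ℝ | z 1 = 0} := by
  simpa using Literature.ModelTheory.ExponentialFields.isSemialgebraic_setOf_eval_eq_zero (k := ℚ)
    (R := ℝ) (X 1 : MvPolynomial (Fin 2) ℚ)

/-- `{z1 = 1} ⊆ ℝ²` is `ℚ`-semialgebraic. [folklore] -/
theorem isSemialgebraic_eq1 : IsSemialgebraic ℚ {z : Fin 2 → ℝ | z 1 = 1} := by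
  have h := Literature.ModelTheory.ExponentialFields.isSemialgebraic_setOf_eval_eq_zero (k := ℚ)
    (R := ℝ) (X 1 - 1 : MvPolynomial (Fin 2) ℚ)
  convert h using 1
  ext z
  simp only [mem_setOf_eq, map_sub, MvPolynomial.aeval_X, map_one, sub_eq_zero]

/-- The closed band is `ℚ`-semialgebraic. [folklore] -/
theorem isSemialgebraic_band : IsSemialgebraic ℚ {z : Fin 2 → ℝ | 0 < z 0 ∧ 0 ≤ z 1 ∧ z 1 ≤ 1} := by
  convert isSemialgebraic_pos0.inter (isSemialgebraic_nonneg1.inter isSemialgebraic_le1) using 1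
  ext z; simp

/-- The open strip is `ℚ`-semialgebraic. [folklore] -/
theorem isSemialgebraic_strip :
    IsSemialgebraic ℚ {z : Fin 2 → ℝ | 0 < z 0 ∧ 0 < z 1 ∧ z 1 < 1} := by
  convert isSemialgebraic_pos0.inter (isSemialgebraic_pos1.inter isSemialgebraic_lt1) using 1
  ext z; simp

/-- The faces are `ℚ`-semialgebraic. [folklore] -/
theorem isSemialgebraic_face :
    IsSemialgebraic ℚ {z : Fin 2 → ℝ | 0 < z 0 ∧ (z 1 = 0 ∨ z 1 = 1)} := by
  convert isSemialgebraic_pos0.inter (isSemialgebraic_eq0.union isSemialgebraic_eq1) using 1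
  ext z; simp

/-! ## The integrand `g z = 1/(1 + z0²)`: semialgebraicity and integrability on the band -/

/-- `g` is a `ℚ`-semialgebraic function on every `ℚ`-semialgebraic set (a rational function with
nonvanishing denominator). [folklore] -/
theorem isSemialgebraicFunOn_g {σ : Set (Fin 2 → ℝ)} (hσ : IsSemialgebraic ℚ σ) :
    IsSemialgebraicFunOn ℚ σ (fun z : Fin 2 → ℝ => 1 / (1 + z 0 ^ 2)) := by
  have h := isSemialgebraicFunOn_aeval_div_aeval hσ (1 : MvPolynomial (Fin 2) ℚ) (1 + X 0 ^ 2)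
    (fun x _ => by
      simp only [map_add, map_one, map_pow, MvPolynomial.aeval_X]
      positivity)
  exact h.congr fun x _ => by
    simp only [map_add, map_one, map_pow, MvPolynomial.aeval_X]

/-- `g` is integrable on the slab `ℝ × [0,1]` (Fubini: `∫ dx/(1+x²) · 1`). [folklore] -/
theorem integrableOn_g_slab :
    IntegrableOn (fun z : Fin 2 → ℝ => 1 / (1 + z 0 ^ 2)) {z : Fin 2 → ℝ | 0 ≤ z 1 ∧ z 1 ≤ 1} := by
  have hf : Integrable (fun t : ℝ => (1 + t ^ 2)⁻¹) := integrable_inv_one_add_sq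
  have hg : Integrable (fun _ : ℝ => (1:ℝ)) (volume.restrict (Icc (0:ℝ) 1)) :=
    integrable_const 1
  have hprod : IntegrableOn (fun p : ℝ × ℝ => (1 + p.1 ^ 2)⁻¹ * 1) (univ ×ˢ Icc (0:ℝ) 1)
      (volume : Measure (ℝ × ℝ)) := by
    rw [Measure.volume_eq_prod, IntegrableOn, ← Measure.prod_restrict, Measure.restrict_univ]
    exact hf.mul_prod hg
  have he := (MeasureTheory.volume_preserving_finTwoArrow ℝ).integrableOn_comp_preimage
    (MeasurableEquiv.measurableEmbedding _) (f := fun p : ℝ × ℝ => (1 + p.1 ^ 2)⁻¹ * 1)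
    (s := univ ×ˢ Icc (0:ℝ) 1)
  have h2 := he.mpr hprod
  have hset :
      (MeasurableEquiv.finTwoArrow : (Fin 2 → ℝ) ≃ᵐ ℝ × ℝ) ⁻¹' (univ ×ˢ Icc (0:ℝ) 1) =
        {z : Fin 2 → ℝ | 0 ≤ z 1 ∧ z 1 ≤ 1} := by
    ext z
    simp [MeasurableEquiv.finTwoArrow_apply]
  rw [hset] at h2
  refine h2.congr_fun (fun z _ => ?_) ?_
  · simp [MeasurableEquiv.finTwoArrow_apply, one_div]
  · have : {z : Fin 2 → ℝ | 0 ≤ z 1 ∧ z 1 ≤ 1} = (fun z : Fin 2 → ℝ => z 1) ⁻¹' Icc 0 1 :=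
      by ext z; simp
    rw [this]
    exact measurableSet_Icc.preimage (measurable_pi_apply 1)

/-! ## Representations -/

/-- The band representation `[{0 < z0} × [0,1], g]` exists (as an absolutely convergent integral of
a `ℚ`-semialgebraic function over a `ℚ`-semialgebraic set). [folklore] -/
theorem exists_bandRep :
    ∃ b : IntegralRep 2, b.domain = {z : Fin 2 → ℝ | 0 < z 0 ∧ 0 ≤ z 1 ∧ z 1 ≤ 1} ∧
      b.integrand = fun z : Fin 2 → ℝ => 1 / (1 + z 0 ^ 2) :=
  ⟨⟨{z : Fin 2 → ℝ | 0 < z 0 ∧ 0 ≤ z 1 ∧ z 1 ≤ 1}, fun z : Fin 2 → ℝ => 1 / (1 + z 0 ^ 2),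
    isSemialgebraic_band, isSemialgebraicFunOn_g isSemialgebraic_band,
    integrableOn_g_slab.mono_set fun _ hz => hz.2⟩, rfl, rfl⟩

/-- The half-line representation `[(0,∞), 1/(1 + y²)]` exists (integrability from the landed
`arctanRep = [ℝ, 1/(2(1+y²))]`). [folklore] -/
theorem exists_halfLineRep :
    ∃ a : IntegralRep 1, a.domain = {y : Fin 1 → ℝ | 0 < y 0} ∧
      a.integrand = fun y => 1 / (1 + y 0 ^ 2) := by
  have hbase : IsSemialgebraic ℚ {y : Fin 1 → ℝ | 0 < y 0} := by
    simpa using Literature.ModelTheory.ExponentialFields.isSemialgebraic_setOf_eval_lt (k := ℚ)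
      (R := ℝ) (0 : MvPolynomial (Fin 1) ℚ) (X 0)
  refine ⟨⟨{y : Fin 1 → ℝ | 0 < y 0}, fun y => 1 / (1 + y 0 ^ 2), hbase, ?_, ?_⟩, rfl, rfl⟩
  · have h := isSemialgebraicFunOn_aeval_div_aeval hbase (1 : MvPolynomial (Fin 1) ℚ)
      (1 + X 0 ^ 2) (fun x _ => by
        simp only [map_add, map_one, map_pow, MvPolynomial.aeval_X]
        positivity)
    exact h.congr fun x _ => by simp only [map_add, map_one, map_pow, MvPolynomial.aeval_X]
  · have h0 : Integrable arctanRep.integrand := integrableOn_univ.mp arctanRep.integrableOn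
    have h : Integrable (fun y : Fin 1 → ℝ => 2 * arctanRep.integrand y) := h0.const_mul 2
    refine (h.congr (ae_of_all _ fun y => ?_)).integrableOn
    simp only [arctanRep_integrand]
    have : (0:ℝ) < 1 + y 0 ^ 2 := by positivity
    field_simp

/-! ## The Newton–Leibniz move -/

/-- `[band] − [half-line]` is ONE Newton–Leibniz move along the last coordinate: base `(0,∞)`,
edges `a ≡ 0 ≤ b ≡ 1`, primitive `F z = z1/(1 + z0²)` with `∂F/∂z1 = g` and
`F(y,1) − F(y,0) = 1/(1 + y²)`. [cite: KontsevichZagier2001, §1.2 rule (3)] -/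
theorem band_sub_halfLine_mem (b : IntegralRep 2)
    (hbd : b.domain = {z : Fin 2 → ℝ | 0 < z 0 ∧ 0 ≤ z 1 ∧ z 1 ≤ 1})
    (hbi : b.integrand = fun z : Fin 2 → ℝ => 1 / (1 + z 0 ^ 2))
    (a : IntegralRep 1) (had : a.domain = {y : Fin 1 → ℝ | 0 < y 0})
    (hai : a.integrand = fun y => 1 / (1 + y 0 ^ 2)) : of b - of a ∈ relations := by
  have hbase : IsSemialgebraic ℚ {y : Fin 1 → ℝ | 0 < y 0} := had ▸ a.isSemialgebraic_domain
  apply newtonLeibnizRel_subset_relations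
  refine ⟨1, b, a, fun _ => 0, fun _ => 1, fun z : Fin 2 → ℝ => z 1 / (1 + z 0 ^ 2),
    ?_, ?_, ?_, ?_, ?_, ?_, ?_, ?_, rfl⟩
  · rw [hbd]
    have h := isSemialgebraicFunOn_aeval_div_aeval isSemialgebraic_band
      (X 1 : MvPolynomial (Fin 2) ℚ) (1 + X 0 ^ 2) (fun x _ => by
        simp only [map_add, map_one, map_pow, MvPolynomial.aeval_X]
        positivity)
    exact h.congr fun x _ => by simp only [map_add, map_one, map_pow, MvPolynomial.aeval_X]
  · rw [had]
    exact (isSemialgebraicFunOn_aeval hbase (0 : MvPolynomial (Fin 1) ℚ)).congr fun x _ => by simp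
  · rw [had]
    exact (isSemialgebraicFunOn_aeval hbase (1 : MvPolynomial (Fin 1) ℚ)).congr fun x _ => by simp
  · intro x _
    norm_num
  · rw [hbd, had]
    ext z
    exact Iff.rfl
  · intro x _
    exact (continuous_id.div_const (1 + x 0 ^ 2)).continuousOn
  · intro x _ t _
    rw [hbi]
    exact (hasDerivAt_id t).div_const (1 + x 0 ^ 2)
  · intro x _
    rw [hai]
    show 1 / (1 + x 0 ^ 2) = 1 / (1 + x 0 ^ 2) - 0 / (1 + x 0 ^ 2)
    rw [zero_div, sub_zero]

end M4

/-- **M4, Newton–Leibniz along the strip**: ONE rule-(3) move along the last coordinate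
`z1 = t ∈ [0,1]` with the primitive `F z = z1/(1 + z0²)` (polynomial in `t`), plus the null faces
`t = 0, 1` (rule 1a), takes the half-strip representation to the half-line representation
`[(0,∞), 1/(1 + y²)]`. [cite: KontsevichZagier2001, §1.2 rule (3)] -/
theorem stub_stripNewtonLeibniz :
    ∀ p : IntegralRep 2, p.domain = {z : Fin 2 → ℝ | 0 < z 0 ∧ 0 < z 1 ∧ z 1 < 1} →
      EqOn p.integrand (fun z => 1 / (1 + z 0 ^ 2)) {z : Fin 2 → ℝ | 0 < z 0 ∧ 0 < z 1 ∧ z 1 < 1} →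
      ∃ a : IntegralRep 1, a.domain = {y : Fin 1 → ℝ | 0 < y 0} ∧
        EqOn a.integrand (fun y => 1 / (1 + y 0 ^ 2)) {y : Fin 1 → ℝ | 0 < y 0} ∧
        Equivalent p a := by
  intro p hpd hpi
  obtain ⟨a, had, hai⟩ := M4.exists_halfLineRep
  obtain ⟨b, hbd, hbi⟩ := M4.exists_bandRep
  refine ⟨a, had, fun y _ => by rw [hai], ?_⟩
  have hsb : {z : Fin 2 → ℝ | 0 < z 0 ∧ 0 < z 1 ∧ z 1 < 1} ⊆ b.domain := by
    rw [hbd]; exact M4.strip_subset_band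
  have hfb : {z : Fin 2 → ℝ | 0 < z 0 ∧ (z 1 = 0 ∨ z 1 = 1)} ⊆ b.domain := by
    rw [hbd]; exact M4.face_subset_band
  -- `p` and the band representation restricted to the open strip agree on the common domain
  have R0 : of p - of (b.restrict _ M4.isSemialgebraic_strip hsb) ∈ relations :=
    of_sub_of_mem_relations_of_eqOn (by rw [hpd]; rfl) fun z hz => by
      rw [hpd] at hz
      show p.integrand z = b.integrand z
      rw [hbi]
      exact hpi hz
  -- rule (1a): `[band] − [strip] − [faces]`
  have R1 : of b - of (b.restrict _ M4.isSemialgebraic_strip hsb) -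
      of (b.restrict _ M4.isSemialgebraic_face hfb) ∈ relations :=
    domainAddRel_subset_relations ⟨2, b, b.restrict _ M4.isSemialgebraic_strip hsb,
      b.restrict _ M4.isSemialgebraic_face hfb, hbd.trans M4.band_eq_union,
      M4.volume_strip_inter_face, fun _ _ => rfl, fun _ _ => rfl, rfl⟩
  -- the faces are null
  have R2 : of (b.restrict _ M4.isSemialgebraic_face hfb) ∈ relations :=
    of_mem_relations_of_volume_eq_zero _ M4.volume_face
  -- rule (3): `[band] − [half-line]`
  have R3 : of b - of a ∈ relations := M4.band_sub_halfLine_mem b hbd hbi a had hai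
  have : of p - of a = (of p - of (b.restrict _ M4.isSemialgebraic_strip hsb)) -
      (of b - of (b.restrict _ M4.isSemialgebraic_strip hsb) -
        of (b.restrict _ M4.isSemialgebraic_face hfb)) -
      of (b.restrict _ M4.isSemialgebraic_face hfb) + (of b - of a) := by abel
  show of p - of a ∈ relations
  rw [this]
  exact relations.add_mem (relations.sub_mem (relations.sub_mem R0 R1) R2) R3

end Summit.KontsevichZagierPeriods.UnfoldedStokes.LegendreAllModuliLine
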